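import Mathlib

/-!
# `ClusteringToYangMills` — negative-side support (cycle 2, file 1/2): the dock line's adapter is not soft over real `β`

Support file for crux `stmt-QuantumFields-9443`
(`Summit.QuantumFields.YangMills.Theses.FradkinShenkerFlow.ClusteringToYangMills`), extracted from the standing
disprover's work file `Cruxes/ClusteringToYangMills/Disproof.lean` (gen 2, cycle 2, §3b).  Pure real analysis:
no tree object, nothing posited, no `def` (the witness is written with local notations).

The crux-idea panel (TRIAGE-r1-1/2/3) merged the three dock cards into one line
`adapter → XiDiverges → CriticalityOfXiDiverges → CriticalContinuumLimit → ClusteringToYangMills` whose only own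
stub is the ADAPTER: per `(G, r)`, the crux hypothesis H (per-β rate, per-pair constants `C(A,B,β)`, all tori,
`n ≤ S`) ⇒ the β-UNIFORM shape of `LatticeGapLargeBeta` / hypothesis 1 of `CriticalContinuumLimit` (β-free
`C(A,B)`, a rate function, volume thresholds).

`abstract_adapter_false`: the adapter is NOT a soft consequence of H.  An explicit family of "pair correlations"
`f j β S n` (pairs `j : ℕ`), a priori bounded by `2` and CONTINUOUS in `β` at each fixed `(j, S, n)`, has the
H-shape at EVERY coupling and violates the β-uniform shape for every tail, rate function and thresholds:
travelling bumps at time `n ≈ 1/|β − q_j|` with `q_j` enumerating `ℚ`; by Baire category some coupling of any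
tail is approximated by the `q_j` faster than `1 / log C_j`, which no rate `m(β) > 0` survives.  So any proof of
the adapter must use a β-regularity of the volume-uniform constants which H does not state and which continuity
of the finite-volume Wilson expectations in `β` does not supply (what suffices: a countable uniform cover of the
tail, `AdapterCover.uniformShape_of_cover`). [folklore]
-/

noncomputable section

open Filter Topology Set Metric

namespace Summit.QuantumFields.YangMills.Theorems.ClusteringToYangMills.Negative

section NonSoftness

/-- `q_j`: an enumeration of `ℚ` inside `ℝ`. -/
local notation3 "𝗊[" j "]" => (((Equiv.symm (Denumerable.eqv ℚ) (j : ℕ) : ℚ) : ℝ))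

/-- The travelling bump: height `2` on `|n − N| ≤ 1`, zero on `|n − N| ≥ 2`. -/
local notation3 "𝖻[" N "," n "]" => ((2 : ℝ) * max 0 (min 1 (2 - |((n : ℕ) : ℝ) - (N : ℝ)|)))

/-- The witness family: pair `j` at coupling `β ≠ q_j` has a bump at `n ≈ 1/|β − q_j|`, and vanishes at `q_j`. -/
local notation3 "𝗐[" j "," β "," n "]" => (if (β : ℝ) = 𝗊[j] then (0 : ℝ) else 𝖻[1 / |(β : ℝ) - 𝗊[j]|, n])

/-- The enumeration `q_j` of `ℚ` has dense range in `ℝ`. [folklore] -/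
theorem denseRange_ratEnum : DenseRange fun j : ℕ => 𝗊[j] := by
  have h : Set.range (fun j : ℕ => 𝗊[j]) = Set.range ((↑) : ℚ → ℝ) := by
    show Set.range (((↑) : ℚ → ℝ) ∘ Equiv.symm (Denumerable.eqv ℚ)) = _
    exact (Equiv.symm (Denumerable.eqv ℚ)).surjective.range_comp _
  show Dense (Set.range fun j : ℕ => 𝗊[j])
  rw [h]
  exact Rat.denseRange_cast

/-- The bump is non-negative. [folklore] -/
theorem bump_nonneg (N : ℝ) (n : ℕ) : 0 ≤ 𝖻[N, n] :=
  mul_nonneg zero_le_two (le_max_left _ _)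

/-- The bump is at most `2`. [folklore] -/
theorem bump_le_two (N : ℝ) (n : ℕ) : 𝖻[N, n] ≤ 2 := by
  have : max 0 (min 1 (2 - |(n : ℝ) - N|)) ≤ 1 := max_le zero_le_one (min_le_left _ _)
  linarith

/-- The bump vanishes two units below its centre. [folklore] -/
theorem bump_eq_zero_of_le {N : ℝ} {n : ℕ} (h : (n : ℝ) + 2 ≤ N) : 𝖻[N, n] = 0 := by
  have habs : |(n : ℝ) - N| = N - n := by
    rw [abs_sub_comm]; exact abs_of_nonneg (by linarith)
  rw [habs, max_eq_left (le_trans (min_le_right _ _) (by linarith)), mul_zero]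

/-- The bump vanishes two units above its centre. [folklore] -/
theorem bump_eq_zero_of_ge {N : ℝ} {n : ℕ} (h : N + 2 ≤ (n : ℝ)) : 𝖻[N, n] = 0 := by
  have habs : |(n : ℝ) - N| = n - N := abs_of_nonneg (by linarith)
  rw [habs, max_eq_left (le_trans (min_le_right _ _) (by linarith)), mul_zero]

/-- The bump has full height `2` within one unit of its centre. [folklore] -/
theorem bump_eq_two_of_abs_lt {N : ℝ} {n : ℕ} (h : |(n : ℝ) - N| < 1) : 𝖻[N, n] = 2 := by
  rw [min_eq_left (by linarith), max_eq_right zero_le_one, mul_one]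

/-- Where the bump is non-zero, the time is less than centre `+ 2`. [folklore] -/
theorem lt_of_bump_ne_zero {N : ℝ} {n : ℕ} (h : 𝖻[N, n] ≠ 0) : (n : ℝ) < N + 2 := by
  by_contra hle
  exact h (bump_eq_zero_of_ge (by linarith))

/-- The witness family is non-negative. [folklore] -/
theorem witness_nonneg (j : ℕ) (β : ℝ) (n : ℕ) : 0 ≤ 𝗐[j, β, n] := by
  split_ifs
  · exact le_rfl
  · exact bump_nonneg _ _

/-- **A priori bound**: the witness family is bounded by `2`. [folklore] -/
theorem abs_witness_le (j : ℕ) (β : ℝ) (n : ℕ) : |𝗐[j, β, n]| ≤ 2 := by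
  rw [abs_of_nonneg (witness_nonneg j β n)]
  split_ifs
  · exact zero_le_two
  · exact bump_le_two _ _

/-- Near `q_j` (and at `q_j`) the witness vanishes identically at each fixed time `n`. [folklore] -/
theorem witness_eq_zero_of_near (j : ℕ) {β : ℝ} (n : ℕ) (h : |β - 𝗊[j]| < 1 / ((n : ℝ) + 2)) :
    𝗐[j, β, n] = 0 := by
  split_ifs with hβ
  · rfl
  · have hpos : 0 < |β - 𝗊[j]| := abs_pos.2 (sub_ne_zero.2 hβ)
    apply bump_eq_zero_of_le
    rw [le_div_iff₀ hpos]
    have hn2 : (0 : ℝ) < n + 2 := by positivity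
    have := (lt_div_iff₀ hn2).1 h
    linarith

/-- **Continuity in the coupling** of every single value of the witness family. [folklore] -/
theorem continuous_witness (j n : ℕ) : Continuous fun β : ℝ => 𝗐[j, β, n] := by
  refine continuous_iff_continuousAt.2 fun β₀ => ?_
  by_cases hβ : β₀ = 𝗊[j]
  · have hev : (fun β : ℝ => 𝗐[j, β, n]) =ᶠ[𝓝 β₀] fun _ => 0 := by
      have hr : (0 : ℝ) < 1 / ((n : ℝ) + 2) := by positivity
      filter_upwards [Metric.ball_mem_nhds β₀ hr] with β hβ'
      refine witness_eq_zero_of_near j n ?_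
      rw [hβ.symm]
      simpa [Real.dist_eq] using hβ'
    exact (continuousAt_const.congr hev.symm)
  · have hev : (fun β : ℝ => 𝗐[j, β, n]) =ᶠ[𝓝 β₀] fun β => 𝖻[1 / |β - 𝗊[j]|, n] := by
      filter_upwards [isOpen_ne.mem_nhds hβ] with β hβ'
      simp [hβ']
    refine ContinuousAt.congr ?_ hev.symm
    have hne : |β₀ - 𝗊[j]| ≠ 0 := abs_ne_zero.2 (sub_ne_zero.2 hβ)
    have h1 : ContinuousAt (fun β : ℝ => 1 / |β - 𝗊[j]|) β₀ :=
      continuousAt_const.div ((continuous_id.sub continuous_const).abs.continuousAt) hne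
    refine continuousAt_const.mul (continuousAt_const.max (continuousAt_const.min ?_))
    exact continuousAt_const.sub ((continuousAt_const.sub h1).abs)

/-- **The H-shape holds at every coupling** for the witness family: rate `1`, constants `2 e^{1/|β − q_j| + 2}`,
uniformly in the volume. [folklore] -/
theorem hShape_witness (β : ℝ) : ∃ m : ℝ, 0 < m ∧ ∀ j : ℕ, ∃ C : ℝ, ∀ S n : ℕ, n ≤ S →
    |𝗐[j, β, n]| ≤ C * Real.exp (-(m * n)) := by
  refine ⟨1, one_pos, fun j => ⟨2 * Real.exp (1 / |β - 𝗊[j]| + 2), fun S n _ => ?_⟩⟩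
  rw [abs_of_nonneg (witness_nonneg _ _ _)]
  by_cases h0 : 𝗐[j, β, n] = 0
  · rw [h0]; positivity
  · have hval : 𝗐[j, β, n] = 𝖻[1 / |β - 𝗊[j]|, n] := by
      split_ifs with hβ
      · exact (h0 (by simp [hβ])).elim
      · rfl
    rw [hval] at h0 ⊢
    have hn : (n : ℝ) < 1 / |β - 𝗊[j]| + 2 := lt_of_bump_ne_zero h0
    have hexp : 1 ≤ Real.exp (1 / |β - 𝗊[j]| + 2) * Real.exp (-(1 * n)) := by
      rw [← Real.exp_add]; exact Real.one_le_exp (by linarith)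
    calc 𝖻[1 / |β - 𝗊[j]|, n] ≤ 2 * 1 := by rw [mul_one]; exact bump_le_two _ _
      _ ≤ 2 * (Real.exp (1 / |β - 𝗊[j]| + 2) * Real.exp (-(1 * n))) :=
          mul_le_mul_of_nonneg_left hexp zero_le_two
      _ = 2 * Real.exp (1 / |β - 𝗊[j]| + 2) * Real.exp (-(1 * n)) := by ring

/-- **… but the β-uniform shape FAILS** for the witness family: for any tail, rate function, thresholds and
β-free constants `C_j`, Baire's theorem gives a coupling in the tail, off every `q_j`, approximated by the `q_j`
faster than `1 / log C_j`; there pair `j`'s bump sits at `n ≈ 1/|β − q_j| ≫ log C_j / m(β)`. [folklore] -/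
theorem not_uniformShape_witness : ¬ ∃ (β₁ : ℝ) (m : ℝ → ℝ) (S₀ : ℝ → ℕ), (∀ β : ℝ, β₁ ≤ β → 0 < m β) ∧
    ∀ j : ℕ, ∃ C : ℝ, ∀ β : ℝ, β₁ ≤ β → ∀ S n : ℕ, S₀ β ≤ S → n ≤ S →
      |𝗐[j, β, n]| ≤ C * Real.exp (-(m β * n)) := by
  rintro ⟨β₁, m, S₀, hm, hC⟩
  choose C hC using hC
  set L : ℕ → ℝ := fun j => max 1 (Real.log (C j)) with hL
  have hL0 : ∀ j, 0 < L j := fun j => lt_of_lt_of_le one_pos (le_max_left _ _)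
  set r : ℕ → ℕ → ℝ := fun j k => 1 / ((k + 2 : ℝ) * L j) with hr
  have hr0 : ∀ j k, 0 < r j k := fun j k => by
    simp only [hr]; exact div_pos one_pos (mul_pos (by positivity) (hL0 j))
  set U : ℕ → Set ℝ := fun k => ⋃ j, ball 𝗊[j] (r j k) with hU
  set V : ℕ → Set ℝ := fun j => {𝗊[j]}ᶜ with hV
  set W : ℕ ⊕ ℕ → Set ℝ := Sum.elim U V with hW
  have hWo : ∀ i, IsOpen (W i) := by
    rintro (k | j)
    · simp only [hW, Sum.elim_inl, hU]; exact isOpen_iUnion fun j => isOpen_ball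
    · simp only [hW, Sum.elim_inr, hV]; exact isOpen_compl_singleton
  have hWd : ∀ i, Dense (W i) := by
    rintro (k | j)
    · simp only [hW, Sum.elim_inl, hU]
      refine denseRange_ratEnum.mono ?_
      rintro _ ⟨j, rfl⟩
      exact Set.mem_iUnion.2 ⟨j, mem_ball_self (hr0 j k)⟩
    · simp only [hW, Sum.elim_inr, hV]; exact dense_compl_singleton _
  have hD : Dense (⋂ i, W i) := dense_iInter_of_isOpen hWo hWd
  obtain ⟨β, hβ1, hβW⟩ := hD.inter_open_nonempty (Ioi β₁) isOpen_Ioi ⟨β₁ + 1, by simp⟩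
  rw [Set.mem_iInter] at hβW
  have hβU : ∀ k, β ∈ U k := fun k => hβW (Sum.inl k)
  have hβV : ∀ j, β ≠ 𝗊[j] := fun j => hβW (Sum.inr j)
  have hβ1' : β₁ ≤ β := le_of_lt hβ1
  have hmβ := hm β hβ1'
  obtain ⟨k, hk⟩ := exists_nat_gt (4 / m β)
  have hk2 : 4 / m β < (k : ℝ) + 2 := by linarith
  have hk2' : 4 < m β * ((k : ℝ) + 2) := by
    rwa [div_lt_iff₀' hmβ] at hk2
  obtain ⟨j, hj⟩ : ∃ j, β ∈ ball 𝗊[j] (r j k) := by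
    simpa [hU] using hβU k
  rw [mem_ball, Real.dist_eq] at hj
  have hδ : 0 < |β - 𝗊[j]| := abs_pos.2 (sub_ne_zero.2 (hβV j))
  set N : ℝ := 1 / |β - 𝗊[j]| with hN
  have hN0 : 0 ≤ N := le_of_lt (div_pos one_pos hδ)
  have hNbig : ((k : ℝ) + 2) * L j < N := by
    rw [hN, lt_div_iff₀ hδ]
    have := (lt_div_iff₀ (mul_pos (by positivity : (0:ℝ) < k + 2) (hL0 j))).1 hj
    linarith [this]
  set n : ℕ := ⌈N⌉₊ with hn
  have hnN : N ≤ n := Nat.le_ceil N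
  have hnN' : (n : ℝ) < N + 1 := Nat.ceil_lt_add_one hN0
  have hval : 𝗐[j, β, n] = 2 := by
    rw [if_neg (hβV j)]
    exact bump_eq_two_of_abs_lt (by rw [abs_lt]; constructor <;> linarith)
  have hb := hC j β hβ1' (max (S₀ β) n) n (le_max_left _ _) (le_max_right _ _)
  rw [hval, abs_of_pos two_pos] at hb
  have hCpos : 0 < C j := by
    by_contra hle; push Not at hle
    nlinarith [Real.exp_pos (-(m β * n))]
  have hlog : m β * n ≤ Real.log (C j) := by
    have h2 : Real.exp (m β * n) * 2 ≤ C j := by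
      have := mul_le_mul_of_nonneg_left hb (Real.exp_pos (m β * n)).le
      rwa [← mul_assoc, mul_comm (Real.exp _) (C j), mul_assoc, ← Real.exp_add,
        add_neg_cancel, Real.exp_zero, mul_one] at this
    have h3 : Real.exp (m β * n) ≤ C j := by linarith [Real.exp_pos (m β * n)]
    exact (Real.le_log_iff_exp_le hCpos).2 h3
  have hlogL : Real.log (C j) ≤ L j := le_max_right _ _
  have h1 : m β * N ≤ L j := le_trans (by nlinarith [hmβ.le]) (hlog.trans hlogL)
  have h2 : m β * (((k : ℝ) + 2) * L j) < m β * N := mul_lt_mul_of_pos_left hNbig hmβ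
  nlinarith [hL0 j, h1, h2, hk2']

/-- **ABSTRACT NON-SOFTNESS OF THE REAL-β ADAPTER.** There is a family of pair correlations `f j β S n`,
a priori bounded by `2` and CONTINUOUS in the coupling at every fixed `(pair, volume, time)`, which has the
shape of the crux hypothesis H at EVERY coupling (per-β rate, per-pair constants uniform in the volume) and
yet does NOT have the β-uniform shape of `LatticeGapLargeBeta` / hypothesis 1 of `CriticalContinuumLimit` on any
tail, for any rate function and any thresholds.  Hence the dock line's adapter cannot be proved from H, the
a priori bound `|corr| ≤ 2‖A‖‖B‖` and continuity of the finite-volume Wilson correlations in `β` alone; compare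
`AdapterCover.uniformShape_of_cover` for what suffices. [folklore] -/
theorem abstract_adapter_false :
    ∃ f : ℕ → ℝ → ℕ → ℕ → ℝ, (∀ j β S n, |f j β S n| ≤ 2) ∧ (∀ j S n, Continuous fun β => f j β S n) ∧
      (∀ β : ℝ, ∃ m : ℝ, 0 < m ∧ ∀ j : ℕ, ∃ C : ℝ, ∀ S n : ℕ, n ≤ S →
        |f j β S n| ≤ C * Real.exp (-(m * n))) ∧
      ¬ ∃ (β₁ : ℝ) (m : ℝ → ℝ) (S₀ : ℝ → ℕ), (∀ β : ℝ, β₁ ≤ β → 0 < m β) ∧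
        ∀ j : ℕ, ∃ C : ℝ, ∀ β : ℝ, β₁ ≤ β → ∀ S n : ℕ, S₀ β ≤ S → n ≤ S →
          |f j β S n| ≤ C * Real.exp (-(m β * n)) :=
  ⟨fun j β _ n => 𝗐[j, β, n], fun j β _ n => abs_witness_le j β n, fun j _ n => continuous_witness j n,
    hShape_witness, not_uniformShape_witness⟩

end NonSoftness

end Summit.QuantumFields.YangMills.Theorems.ClusteringToYangMills.Negative

end
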